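import Literature.MathematicalPhysics.QuantumFieldTheory.Balaban1983to89.B9Thm37GlueSz
import Literature.MathematicalPhysics.QuantumFieldTheory.Balaban1983to89.B5DirichletDg

/-!
# B9Thm37GluePU — the partition-of-unity binders of the `B9Thm37GlueSz` entry theorems DISCHARGED in the
nearest-neighbour torus model from the smooth partition of unity of `B5SmoothPartition` (sibling leaf of
`B9Thm37GlueSz` v2; own lineage pv21; imports `B9Thm37GlueSz` and `B5DirichletDg` (⊃ `B5Leibniz121` ⊃
`B5SmoothPartition`) only; modifies nothing, consumes the b05 lineage's declarations BY NAME)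

[B9] T. Bałaban, *Propagators for lattice gauge theories in a background field*, Commun. Math. Phys. **99** (1985)
389–434 [cite: Balaban1985BackgroundPropagators]; [4] = T. Bałaban, *Propagators and renormalization transformations
for lattice gauge theories. II*, Commun. Math. Phys. **96** (1984) 223–250 [cite: Balaban1984PropagatorsII]; [3] =
T. Bałaban, *Propagators and renormalization transformations for lattice gauge theories. I*, Commun. Math. Phys. **95**
(1984) 17–40 [cite: Balaban1984PropagatorsI].

[B9] p. 408 (verbatim; render `1985-cmp99-background-propagators-p020-x2.png` of the cell archive
`HOME/b2b-balaban-ref1/pages/` read as image, text layer `paper:balaban1985-cmp99-background-propagators` p0020 for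
search): *"Each set B^j(Λ_j) is a union of big blocks, which are elementary cubes (cells) of the lattice ML^jηZ^d (or
rather the lattice T^{(j+m)}_{ML^jη}, if M = L^m). We take a family 𝒟_j of cubes □, with centers at points of this
lattice, which are unions of 2^d big blocks, with at least one of them contained in B^j(Λ_j). A union of these
families for all j is denoted by 𝒟. Let us take here the set T_1∖Ω_1 instead of Λ_0 = Ω_0∖Ω_1. The family 𝒟 is a
partition of the lattice T. We take the partition of unity {h_□} defined at the end of Sect. A in [4]. We have
Σ_{□∈𝒟} h_□² = 1."*; [4] p. 229 (verbatim, as certified in the header of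
`B9Thm37GlueSz`): *"We construct also the corresponding family of functions h described in (1.118), and rescale them
to proper scales. They satisfy Σ_{□∈𝒟} h²_□ = 1. (2.36)"*; [3] p. 36, (1.118) (verbatim, as certified in the headers
of `B5Local114`, `B5TorusPartition`, `B5SmoothPartition`): *"We construct a partition of unity taking the functions
h_z(x) = Π_{μ=1}^d h((x_μ − z_μ)/M₀), h ∈ C₀^∞(]−⅔, ⅔[), h(t) = 1 for t ∈ [−⅓, ⅓], h is chosen in such a way that
Σ_n h²(t − n) = 1, hence Σ_z h_z²(x) = 1. (1.118)"*; [B9] p. 400, (3.50) and p. 409, (3.88) as certified in the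
header of `B9Thm37GlueSt` (the star st(x) consists of ALL 2d bonds at x; (Δh)(x) is the coefficient `slap`).
No new printed locus is read by this module beyond the p. 408 sentences above.

THE POINT.  The four entry theorems `B9Thm37GlueSz.thm37_entry{1,2,3,4}_of_342_lattice_of_387_sz` (Theorem 3.7 ⇒
the entries of (3.42) for G′ = Σ_□ h_□G′_□h_□, (3.87)) carry the partition of unity ABSTRACTLY: a family
`hs : ι → St → ℝ` on an abstract lattice `St` with abstract bonds `src tgt : Bd → St` and bond weights `c`, under the
binders `hh` (|h_□| ≦ 1), `hsq` (Σ_□ h_□² = 1 — (2.36)), `hθ0`/`hθ` (per-bond first differences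
|c(b)(h_□(b₊) − h_□(b₋))| ≦ θ_□), `hθ₂0`/`hθ₂` (|(Δh_□)(x)| = |`slap` h_□ (x)| ≦ θ_{2,□}) and the star counts `hNs`,
`hNt` (≦ N_d bonds start / end at a point) — the lineage's binder-flow map (cell file
`HOME/b2b-balaban-pv21-g6/LINEAGE.md`, row `hθ0 hθ hθ₂0 hθ₂`) records them as RESIDUAL NUMERICS: print says only that
h_□ is the rescaled profile of (1.118) on the cube scale ([4] p. 229), whence ∂h_□ = O((ML^jη)^{−1}),
Δh_□ = O((ML^jη)^{−2}) silently.  THIS FILE discharges all eight binders BY NAME in the cell's typed model of exactly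
that sentence: the lattice is the finite torus `St := B5TorusCover.UT N` (periods `N_i`), the bonds are the
positively oriented nearest-neighbour bonds `Bd := UT N × Fin d`, `src (x, μ) = x`, `tgt (x, μ) = x + e_μ`
(`B5Leibniz121.up`), the bond weight is a constant `c₀` (print: η^{−1}, (3.3)/(3.23)), the partition index is the
centre set `ι := B5TorusCover.Ctr N M₀` of the cube cover and `hs := B5SmoothPartition.hSU N M₀` is the b05
lineage's `C^{1,1}` partition of unity ((1.118) with Σ_z h_z² = 1 EXACT: `B5SmoothPartition.sum_hSU_sq`).  Then:
`hh` ⇐ `hSU_mem_Icc`; `hsq` ⇐ `sum_hSU_sq` (periods divisible by M₀ and ≧ 2M₀); `hθ` with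
θ_□ = |c₀|·4d/M₀ ⇐ `hSU_lipschitz` + `B5Leibniz121.dist_up_le`; `hθ₂` with θ_{2,□} = c₀²·52d/M₀² ⇐ the identity
`slap = −c₀² Σ_μ (h(x + e_μ) − 2h(x) + h(x − e_μ))` (§2, the U = 1 case of (3.50): "η^{−2}(2dλ(x) − Σ_{b∈st(x)} λ(b₊))")
and `B5Leibniz121.abs_hSU_centred_le`; `hNs`, `hNt` with N_d = d (each point starts d and ends d positively oriented
bonds; st(x) of (3.50) = both halves, 2d bonds).  In the η-dictionary of the headers of `B5SmoothPartition` /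
`B5Leibniz121` (cube of M L^j η / η = ML^j lattice steps in the rôle of M₀, c₀ = η^{−1}) these are print's orders:
θ_□ = 4d·η^{−1}/(ML^j) = 4d/(ML^jη), θ_{2,□} = 52d·η^{−2}/(ML^j)² = 52d/(ML^jη)².

CONTENTS.  §1 the bond model: `bsrc`, `btgt`, `up_eq_iff` (y + e_μ = x ⟺ y = x − e_μ, from `B5DirichletDg.dn_up`), the star counts
`card_src_star` / `card_tgt_star` (= d) and the binders `hNs_torus`, `hNt_torus`.  §2 `slap_torus`: the scalar
lattice Laplacian coefficient `B9Thm37GlueSt.slap` of the model is −c₀² × the sum over axes of centred second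
differences.  §3 the binders: `hh_torus`, `hsq_torus`, `hθ0_torus`, `hθ_torus`, `hθ₂0_torus`, `hθ₂_torus` in the
literal shapes of `B9Thm37GlueSz` (with `c := fun _ => c₀`, `θ := fun _ => |c₀|·4d/M₀`, `θ₂ := fun _ => c₀²·52d/M₀²`).
§4 located support in the model (towards `hsupp`, which needs the block maps and is NOT discharged here):
`hSU_eq_zero_of_far` and `near_ctr_of_dh_ne` — a bond on which h_z changes has both endpoints within torus distance
< M₀ + 1 of the centre z.  §5 **entry 4 of (3.42) for G′ in the torus model** `thm37_entry4_torus` =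
`B9Thm37GlueSz.thm37_entry4_of_342_lattice_of_387_sz` with the eight binders discharged (every other hypothesis —
geometry / block maps into `B9.Geometry`, Corollary 3.6 for the G′_□ (`h342_*`), `hS`, `hsupp`, `hadj`, `hV₁`, `hV₂`,
the Q-data, `hloc`, `hinv`, Lemma 2.1 of [4], located smallness — is carried verbatim as a hypothesis).  §6 two
non-vacuity `example`s (the model's side conditions 1 ≦ M₀, M₀ ∣ N_i, 2M₀ ≦ N_i, N_i ≠ 0 are jointly satisfiable:
d = 1, N = 2, M₀ = 1; and `hθ₂_torus` instantiated there).

NOT ASSERTED.  Nothing printed is asserted: the sizes are those of the b05 MODEL profile (DIVERGENCE D-b05g5.4: a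
`C^{1,1}` cosine-of-cubic-step profile supported in the cube □_z itself, not Bałaban's `C₀^∞` profile with plateau;
constants 4 and 52 unoptimised); the multi-scale cube family 𝒟 of [4] p. 229 (cubes of DIFFERENT sizes 2ML^jη over
the regions Λ_j) is NOT modelled — this is the ONE-SCALE torus (all cubes of one size 2M₀, as in (1.118)), i.e. the
model of one region Λ_j; the block maps `blk`, `blkY` into the B9 geometry and every hypothesis about them remain
hypotheses.  Value: kernel-checked bookkeeping (eight hypothesis binders of the lineage's entry theorems replaced by
the cell's typed partition of unity), NOT summit progress.
-/

namespace Literature.MathematicalPhysics.QuantumFieldTheory.Balaban1983to89.B9Thm37GluePU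

open Finset B6RandomWalk B6RandomWalkHom B9Thm37Sum B9Thm34Ext B9Thm37Glue B9Thm37GlueT B9Thm37GlueSt B9Thm37GlueSz
open B5TorusCover (UT Ctr ctr ctrU)
open B5SmoothPartition (hS hSU hSU_lipschitz hSU_mem_Icc sum_hSU_sq hS_eq_zero_of_le)
open B5Leibniz121 (up dn up_dn dist_up_le dist_dn_le abs_hSU_centred_le)
open B5DirichletDg (dn_up eq_up_iff)

noncomputable section

variable {d : ℕ} {N : Fin d → ℕ}

/-! ## §1  The nearest-neighbour bond model of the finite torus: bonds `(x, μ) : x → x + e_μ` -/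

section Bonds

/-- MODEL. Source of the positively oriented bond `(x, μ)`: the point `x`. [cite: Balaban1985BackgroundPropagators, (3.3) p.391 + (3.50) p.400] -/
def bsrc (b : UT N × Fin d) : UT N := b.1

/-- Unfolding of `bsrc`. [folklore] -/
@[simp] theorem bsrc_apply (x : UT N) (μ : Fin d) : bsrc (x, μ) = x := rfl

/-- Exactly `d` positively oriented bonds START at each point (the positive half of st(x), (3.50)). [cite: Balaban1985BackgroundPropagators, (3.50) p.400] -/
theorem card_src_star (x : UT N) :
    (Finset.univ.filter (fun b : UT N × Fin d => bsrc b = x)).card = d := by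
  have h : Finset.univ.filter (fun b : UT N × Fin d => bsrc b = x) = ({x} : Finset (UT N)) ×ˢ Finset.univ := by
    ext ⟨y, μ⟩
    simp [bsrc, eq_comm]
  rw [h, Finset.card_product, Finset.card_singleton, Finset.card_univ, Fintype.card_fin, one_mul]

/-- **The binder `hNs` of `B9Thm37GlueSz` in the torus model** with `Nd := d`. [cite: Balaban1985BackgroundPropagators, (3.50) p.400] -/
theorem hNs_torus : ∀ x : UT N, (Finset.univ.filter (fun b : UT N × Fin d => bsrc b = x)).card ≤ d :=
  fun x => (card_src_star x).le

variable [∀ i, NeZero (N i)]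

/-- MODEL. Target of the positively oriented bond `(x, μ)`: the point `x + e_μ` (`B5Leibniz121.up`). [cite: Balaban1985BackgroundPropagators, (3.3) p.391 + (3.50) p.400] -/
def btgt (b : UT N × Fin d) : UT N := up b.1 b.2

/-- Unfolding of `btgt`. [folklore] -/
@[simp] theorem btgt_apply (x : UT N) (μ : Fin d) : btgt (x, μ) = up x μ := rfl

/-- `y + e_μ = x ⟺ y = x − e_μ` (from `B5DirichletDg.eq_up_iff` / `dn_up`). [folklore] -/
theorem up_eq_iff (y x : UT N) (μ : Fin d) : up y μ = x ↔ y = dn x μ :=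
  eq_comm.trans (eq_up_iff y x μ)

/-- Exactly `d` positively oriented bonds END at each point (the negative half of st(x), (3.50)). [cite: Balaban1985BackgroundPropagators, (3.50) p.400] -/
theorem card_tgt_star (x : UT N) :
    (Finset.univ.filter (fun b : UT N × Fin d => btgt b = x)).card = d := by
  have h : Finset.univ.filter (fun b : UT N × Fin d => btgt b = x) =
      Finset.univ.image (fun μ : Fin d => (dn x μ, μ)) := by
    ext ⟨y, μ⟩
    simp only [Finset.mem_filter, Finset.mem_univ, true_and, Finset.mem_image, btgt_apply, Prod.mk.injEq]
    constructor
    · intro hy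
      exact ⟨μ, ((up_eq_iff y x μ).mp hy).symm, rfl⟩
    · rintro ⟨ν, hν, rfl⟩
      rw [← hν, up_dn]
  rw [h, Finset.card_image_of_injective _ (fun μ ν hμν => (Prod.mk.inj hμν).2), Finset.card_univ, Fintype.card_fin]

/-- **The binder `hNt` of `B9Thm37GlueSz` in the torus model** with `Nd := d`. [cite: Balaban1985BackgroundPropagators, (3.50) p.400] -/
theorem hNt_torus : ∀ x : UT N, (Finset.univ.filter (fun b : UT N × Fin d => btgt b = x)).card ≤ d :=
  fun x => (card_tgt_star x).le

end Bonds

/-! ## §2  The scalar Laplacian coefficient `slap` of the model is `−c₀² Σ_μ` (centred second differences) -/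

section Slap

variable [∀ i, NeZero (N i)]

/-- **`slap` in the torus model** ((3.50) at U = 1 with constant bond weight c₀: (Δh)(x) = c₀²(2d·h(x) − Σ_{b∈st(x)} h(b₊))):
`slap bsrc btgt c₀ h x = −c₀² Σ_μ (h(x + e_μ) − 2h(x) + h(x − e_μ))`. [cite: Balaban1985BackgroundPropagators, (3.50) p.400 + (3.23) p.394] -/
theorem slap_torus (c₀ : ℝ) (h : UT N → ℝ) (x : UT N) :
    slap bsrc btgt (fun _ : UT N × Fin d => c₀) h x = -(c₀ ^ 2 * ∑ μ : Fin d, (h (up x μ) - 2 * h x + h (dn x μ))) := by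
  rw [slap_apply, Fintype.sum_prod_type, Finset.sum_comm, Finset.mul_sum, ← Finset.sum_neg_distrib]
  refine Finset.sum_congr rfl fun μ _ => ?_
  simp only [bsrc_apply, btgt_apply]
  rw [Finset.sum_sub_distrib]
  have h1 : ∑ y : UT N, (if up y μ = x then c₀ * (c₀ * (h (up y μ) - h y)) else 0)
      = c₀ * (c₀ * (h x - h (dn x μ))) := by
    rw [Finset.sum_eq_single (dn x μ) (fun y _ hy => if_neg fun h' => hy ((up_eq_iff y x μ).mp h'))
      (fun h' => absurd (Finset.mem_univ _) h'), if_pos (up_dn x μ), up_dn]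
  have h2 : ∑ y : UT N, (if y = x then c₀ * (c₀ * (h (up y μ) - h y)) else 0)
      = c₀ * (c₀ * (h (up x μ) - h x)) := by
    rw [Finset.sum_eq_single x (fun y _ hy => if_neg hy) (fun h' => absurd (Finset.mem_univ _) h'), if_pos rfl]
  rw [h1, h2]
  ring

/-- Consequently `|slap h (x)| ≦ c₀² Σ_μ |h(x + e_μ) − 2h(x) + h(x − e_μ)|`. [folklore] -/
theorem abs_slap_torus_le (c₀ : ℝ) (h : UT N → ℝ) (x : UT N) :
    |slap bsrc btgt (fun _ : UT N × Fin d => c₀) h x| ≤ c₀ ^ 2 * ∑ μ : Fin d, |h (up x μ) - 2 * h x + h (dn x μ)| := by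
  rw [slap_torus, abs_neg, abs_mul, abs_of_nonneg (sq_nonneg c₀)]
  exact mul_le_mul_of_nonneg_left (Finset.abs_sum_le_sum_abs _ _) (sq_nonneg c₀)

end Slap

/-! ## §3  The eight partition-of-unity binders of `B9Thm37GlueSz`, DISCHARGED for `hs := hSU N M₀` -/

section Binders

/-- **`hsq`** = (2.36) / (1.118): Σ_z h_z(x)² = 1, EXACTLY, for periods divisible by M₀ and ≧ 2M₀.
[cite: Balaban1985BackgroundPropagators, p.408 («We have Σ_□ h_□² = 1»); Balaban1984PropagatorsII, (2.36) p.229; Balaban1984PropagatorsI, (1.118) p.36] -/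
theorem hsq_torus {M₀ : ℕ} (hM : 1 ≤ M₀) (hdiv : ∀ i, M₀ ∣ N i) (h2N : ∀ i, 2 * M₀ ≤ N i) :
    ∀ x : UT N, ∑ z : Ctr N M₀, hSU N M₀ z x ^ 2 = 1 :=
  fun x => sum_hSU_sq N hM hdiv h2N x

/-- **`hθ0`**: the per-bond size θ = |c₀|·4d/M₀ is nonnegative. [folklore] -/
theorem hθ0_torus (M₀ : ℕ) (c₀ : ℝ) : ∀ _z : Ctr N M₀, 0 ≤ |c₀| * (4 * d / (M₀ : ℝ)) :=
  fun _ => by positivity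

/-- **`hθ₂0`**: the second-difference size θ₂ = c₀²·52d/M₀² is nonnegative. [folklore] -/
theorem hθ₂0_torus (M₀ : ℕ) (c₀ : ℝ) : ∀ _z : Ctr N M₀, 0 ≤ c₀ ^ 2 * (52 * d / (M₀ : ℝ) ^ 2) :=
  fun _ => by positivity

variable [∀ i, NeZero (N i)]

/-- **`hh`**: |h_z(x)| ≦ 1. [cite: Balaban1984PropagatorsI, (1.118) p.36] -/
theorem hh_torus (M₀ : ℕ) : ∀ (z : Ctr N M₀) (x : UT N), |hSU N M₀ z x| ≤ 1 := fun z x => by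
  obtain ⟨h0, h1⟩ := hSU_mem_Icc N M₀ z x
  rw [abs_of_nonneg h0]
  exact h1

/-- **`hθ`**: per-bond first differences |c₀(h_z(x + e_μ) − h_z(x))| ≦ |c₀|·4d/M₀ (the ∂h = O(M₀⁻¹) of (1.121), with
the bond weight). [cite: Balaban1984PropagatorsI, (1.118) p.36 + (1.121) p.37; Balaban1985BackgroundPropagators, (3.88) p.409] -/
theorem hθ_torus {M₀ : ℕ} (hM : 1 ≤ M₀) (c₀ : ℝ) :
    ∀ (z : Ctr N M₀) (b : UT N × Fin d),
      |(fun _ : UT N × Fin d => c₀) b * (hSU N M₀ z (btgt b) - hSU N M₀ z (bsrc b))| ≤ |c₀| * (4 * d / (M₀ : ℝ)) := by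
  rintro z ⟨x, μ⟩
  simp only [bsrc_apply, btgt_apply]
  rw [abs_mul]
  refine mul_le_mul_of_nonneg_left ?_ (abs_nonneg c₀)
  have hM0 : (0 : ℝ) < M₀ := by exact_mod_cast hM
  have h1 := hSU_lipschitz N hM z (up x μ) x
  have h2 : dist (up x μ) x ≤ 1 := by
    rw [dist_comm]
    exact dist_up_le x μ
  calc |hSU N M₀ z (up x μ) - hSU N M₀ z x| ≤ 4 * d / M₀ * dist (up x μ) x := h1
    _ ≤ 4 * d / M₀ * 1 := mul_le_mul_of_nonneg_left h2 (by positivity)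
    _ = 4 * d / (M₀ : ℝ) := mul_one _

/-- **`hθ₂`**: |(Δh_z)(x)| = |slap h_z (x)| ≦ c₀²·52d/M₀² (the Δh = O(M₀⁻²) of (1.121): sum over the d axes of the
centred second differences ≦ 52/M₀² of the b05 profile). [cite: Balaban1984PropagatorsI, (1.121) p.37; Balaban1985BackgroundPropagators, (3.50) p.400 + (3.88) p.409] -/
theorem hθ₂_torus {M₀ : ℕ} (hM : 1 ≤ M₀) (h2N : ∀ i, 2 * M₀ ≤ N i) (c₀ : ℝ) :
    ∀ (z : Ctr N M₀) (x : UT N),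
      |slap bsrc btgt (fun _ : UT N × Fin d => c₀) (hSU N M₀ z) x| ≤ c₀ ^ 2 * (52 * d / (M₀ : ℝ) ^ 2) := by
  intro z x
  refine (abs_slap_torus_le c₀ (hSU N M₀ z) x).trans (mul_le_mul_of_nonneg_left ?_ (sq_nonneg c₀))
  calc ∑ μ : Fin d, |hSU N M₀ z (up x μ) - 2 * hSU N M₀ z x + hSU N M₀ z (dn x μ)|
      ≤ ∑ _μ : Fin d, 52 / (M₀ : ℝ) ^ 2 := Finset.sum_le_sum fun μ _ => abs_hSU_centred_le hM h2N z x μ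
    _ = 52 * d / (M₀ : ℝ) ^ 2 := by
        rw [Finset.sum_const, Finset.card_univ, Fintype.card_fin, nsmul_eq_mul]
        ring

end Binders

/-! ## §4  Located support of ∂h_z in the model (towards `hsupp`; the block maps are NOT modelled) -/

section Support

variable [∀ i, NeZero (N i)]

/-- `h_z(x) = 0` once `dist(x, z) ≧ M₀` on the carrier (support of h_z ⊂ □_z). [cite: Balaban1984PropagatorsI, (1.118) p.36 (supp h_z ⊂ □_z)] -/
theorem hSU_eq_zero_of_far {M₀ : ℕ} (hM : 1 ≤ M₀) {z : Ctr N M₀} {x : UT N}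
    (h : (M₀ : ℝ) ≤ dist x (ctrU N M₀ z)) : hSU N M₀ z x = 0 :=
  hS_eq_zero_of_le (UT.one_le N) hM (by rwa [UT.dist_eq] at h)

/-- **Located support of ∂h_z**: if h_z changes along the bond x → x + e_μ then BOTH endpoints lie within torus
distance < M₀ + 1 of the centre z (the datum behind `hsupp`: ∂h_□ is supported in the blocks meeting □~).
[cite: Balaban1984PropagatorsI, (1.118) p.36; Balaban1985BackgroundPropagators, (3.88)–(3.89) p.409] -/
theorem near_ctr_of_dh_ne {M₀ : ℕ} (hM : 1 ≤ M₀) (z : Ctr N M₀) (x : UT N) (μ : Fin d)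
    (hne : hSU N M₀ z (up x μ) ≠ hSU N M₀ z x) :
    dist x (ctrU N M₀ z) < M₀ + 1 ∧ dist (up x μ) (ctrU N M₀ z) < M₀ + 1 := by
  have hxu : dist x (up x μ) ≤ 1 := dist_up_le x μ
  by_cases hx : dist x (ctrU N M₀ z) < M₀
  · refine ⟨by linarith, ?_⟩
    calc dist (up x μ) (ctrU N M₀ z) ≤ dist (up x μ) x + dist x (ctrU N M₀ z) := dist_triangle _ _ _
      _ < 1 + M₀ := by rw [dist_comm (up x μ) x]; linarith
      _ = M₀ + 1 := add_comm _ _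
  · by_cases hu : dist (up x μ) (ctrU N M₀ z) < M₀
    · refine ⟨?_, by linarith⟩
      calc dist x (ctrU N M₀ z) ≤ dist x (up x μ) + dist (up x μ) (ctrU N M₀ z) := dist_triangle _ _ _
        _ < 1 + M₀ := by linarith
        _ = M₀ + 1 := add_comm _ _
    · exfalso
      apply hne
      rw [hSU_eq_zero_of_far hM (not_lt.mp hx), hSU_eq_zero_of_far hM (not_lt.mp hu)]

end Support

/-! ## §5  Entry 4 of (3.42) for G′ in the torus model: the eight binders discharged by name -/

section Entry4

variable [∀ i, NeZero (N i)] {g : B9.Geometry} [Fintype g.Site] [DecidableEq g.Site] {R : ℝ} {H : Prop} {Cp : Type}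

/-- **Theorem 3.7 ⇒ entry 4 of (3.42) for G′ (Δ_UG′, weight 1) IN THE TORUS MODEL OF THE PARTITION OF UNITY** =
`B9Thm37GlueSz.thm37_entry4_of_342_lattice_of_387_sz` with `St := UT N`, `Bd := UT N × Fin d` (positively oriented
nearest-neighbour bonds), `src := bsrc`, `tgt := btgt`, constant bond weight `c₀`, `ι := Ctr N M₀`,
`hs := hSU N M₀`, `θ_□ := |c₀|·4d/M₀`, `θ_{2,□} := c₀²·52d/M₀²`, `N_d := d`, and the binders `hh`, `hsq`, `hθ0`, `hθ`,
`hθ₂0`, `hθ₂`, `hNs`, `hNt` DISCHARGED (§1–§3); every other hypothesis is carried verbatim (NOT asserted: Corollary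
3.6 for the G′_□, the block maps and their geometry, the volume products, the Q-data, `hloc`, `hinv`, Lemma 2.1 of
[4], located smallness).  [cite: Balaban1985BackgroundPropagators, Thm 3.7 (3.87)–(3.90) pp.408–410 + (3.42) p.397 + (3.50) p.400; Balaban1984PropagatorsII, (2.36) p.229 + (2.40)–(2.44) p.230; Balaban1984PropagatorsI, (1.118) p.36] -/
theorem thm37_entry4_torus [Fintype Cp] [DecidableEq Cp] {M₀ : ℕ} (hM : 1 ≤ M₀) (hdiv : ∀ i, M₀ ∣ N i)
    (h2N : ∀ i, 2 * M₀ ≤ N i) (c₀ : ℝ)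
    (blk : UT N × Cp → g.Site) (blkY : (UT N × Fin d) × Cp → g.Site)
    (Rm : UT N × Fin d → Cp → Cp → ℝ) (Qf : Module.End ℝ (UT N × Cp → ℝ)) (dd : ℕ) (δ₀ α ρ B₀ v₁ v₂ κQ Nn N' : ℝ)
    (S S' : Ctr N M₀ → Finset g.Site)
    (KQ : Ctr N M₀ → g.Site → g.Site → ℝ) {G' : Module.End ℝ (UT N × Cp → ℝ)}
    (hRm : ∀ b i j, ∑ k, Rm b k i * Rm b k j = if i = j then 1 else 0)
    (hB₀ : 0 ≤ B₀) (hδ₀ : 0 ≤ δ₀) (hρ : 0 ≤ ρ) (hv₁ : 0 ≤ v₁) (hv₂ : 0 ≤ v₂) (hκQ : 0 ≤ κQ) (hN : 0 ≤ Nn)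
    (hN' : 0 ≤ N') (hαδ : 0 ≤ (1 - α) * δ₀)
    (htri : Triangle254 (toB6 g R H)) (hrefl : ∀ y : g.Site, g.dist y y = 0)
    (hdnn : ∀ y y' : g.Site, 0 ≤ g.dist y y') (hlen : ∀ y : g.Site, 0 ≤ g.len y)
    (h261 : Ineq261 dd (toB6 g R H) δ₀ α) (h263 : Ineq263 dd (toB6 g R H) δ₀ α)
    (hsmall : N' * (B₀ * Real.exp (δ₀ * ρ) * ((d + d * Fintype.card Cp : ℝ) * v₁ + (v₂ + κQ))) *
      B6.c1 dd δ₀ α < 1)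
    (hS : ∀ i (p : UT N × Cp), hSU N M₀ i p.1 ≠ 0 → blk p ∈ S i)
    (hcnt : ∀ a : g.Site, (∑ i, if a ∈ S i then (1 : ℝ) else 0) ≤ Nn)
    (hcnt' : ∀ a : g.Site, (∑ i, if a ∈ S' i then (1 : ℝ) else 0) ≤ N')
    (hsupp : ∀ i b, hSU N M₀ i (btgt b) ≠ hSU N M₀ i (bsrc b) →
      (∀ j, blk (bsrc b, j) ∈ S' i ∧ blk (btgt b, j) ∈ S' i) ∧ ∀ k, blkY (b, k) ∈ S' i)
    (hadj : ∀ b i k, g.dist (blk (bsrc b, i)) (blkY (b, k)) ≤ ρ ∧ g.dist (blk (btgt b, i)) (blkY (b, k)) ≤ ρ ∧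
      g.dist (blkY (b, k)) (blk (bsrc b, i)) ≤ ρ ∧ g.dist (blkY (b, k)) (blk (btgt b, i)) ≤ ρ)
    (hV₁ : ∀ i (a : g.Site), a ∈ S' i →
      |c₀| * (4 * d / (M₀ : ℝ)) * ∑ y ∈ (S' i).filter (fun y => g.dist a y ≤ ρ), g.len y ≤ v₁)
    (hV₂ : ∀ i (a : g.Site), a ∈ S' i → c₀ ^ 2 * (52 * d / (M₀ : ℝ) ^ 2) * g.len a ^ 2 ≤ v₂)
    (hKQ : ∀ i a b, 0 ≤ KQ i a b) (hlocQ : ∀ i a y'', KQ i a y'' ≠ 0 → g.dist a y'' ≤ ρ)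
    (hrowQ : ∀ i (a : g.Site), ∑ y'' : g.Site, KQ i a y'' * g.len y'' ^ 2 ≤ if a ∈ S' i then κQ else 0)
    {Gsq : Ctr N M₀ → Module.End ℝ (UT N × Cp → ℝ)}
    (h342_1 : ∀ i, HasMajorant (g := toB6 g R H) blk (Gsq i)
      (fun a b => B₀ * g.len a ^ 2 * Real.exp (-(δ₀ * g.dist a b))))
    (h342_2 : ∀ i, HasMajorantHom (g := toB6 g R H) blk blkY
      (covD bsrc btgt (fun _ : UT N × Fin d => c₀) Rm ∘ₗ Gsq i)
      (fun a b => B₀ * g.len a * Real.exp (-(δ₀ * g.dist a b))))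
    (h342_4 : ∀ i, HasMajorantHom (g := toB6 g R H) blk blk
      ((covDT bsrc btgt (fun _ : UT N × Fin d => c₀) Rm ∘ₗ covD bsrc btgt (fun _ : UT N × Fin d => c₀) Rm) ∘ₗ
        Gsq i)
      (fun a b => B₀ * Real.exp (-(δ₀ * g.dist a b))))
    (hQ : ∀ i, HasMajorant (g := toB6 g R H) blk
      (mulOp (hSU N M₀ i ∘ Prod.fst) * Qf - Qf * mulOp (hSU N M₀ i ∘ Prod.fst)) (KQ i))
    (hloc : ∀ i, mulOp (hSU N M₀ i ∘ Prod.fst) *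
      (covDT bsrc btgt (fun _ : UT N × Fin d => c₀) Rm ∘ₗ covD bsrc btgt (fun _ : UT N × Fin d => c₀) Rm + Qf) *
      Gsq i * mulOp (hSU N M₀ i ∘ Prod.fst) = mulOp (hSU N M₀ i ∘ Prod.fst) * mulOp (hSU N M₀ i ∘ Prod.fst))
    (hinv : G' * (covDT bsrc btgt (fun _ : UT N × Fin d => c₀) Rm ∘ₗ
      covD bsrc btgt (fun _ : UT N × Fin d => c₀) Rm + Qf) = 1) :
    HasMajorantHom (g := toB6 g R H) blk blk
      ((covDT bsrc btgt (fun _ : UT N × Fin d => c₀) Rm ∘ₗ covD bsrc btgt (fun _ : UT N × Fin d => c₀) Rm) ∘ₗ G')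
      (fun (a b : g.Site) => B₀ * (Nn + N' * Real.exp (δ₀ * ρ) * ((d + d * Fintype.card Cp : ℝ) * v₁ + v₂)) *
        B6.c1 dd δ₀ α *
        (1 - N' * (B₀ * Real.exp (δ₀ * ρ) * ((d + d * Fintype.card Cp : ℝ) * v₁ + (v₂ + κQ))) *
          B6.c1 dd δ₀ α)⁻¹ *
        Real.exp (-((1 - α) * δ₀ * g.dist a b))) :=
  thm37_entry4_of_342_lattice_of_387_sz blk blkY bsrc btgt (fun _ : UT N × Fin d => c₀) Rm Qf dd d δ₀ α ρ B₀ v₁ v₂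
    κQ Nn N' S S' (hSU N M₀) (fun _ => |c₀| * (4 * d / (M₀ : ℝ))) (fun _ => c₀ ^ 2 * (52 * d / (M₀ : ℝ) ^ 2)) KQ
    hRm hB₀ hδ₀ hρ hv₁ hv₂ hκQ hN hN' hαδ htri hrefl hdnn hlen h261 h263 hsmall (hh_torus M₀) hS hcnt hcnt'
    (hθ0_torus M₀ c₀) (hθ_torus hM c₀) (hθ₂0_torus M₀ c₀) (hθ₂_torus hM h2N c₀) hsupp hNs_torus hNt_torus hadj
    hV₁ hV₂ hKQ hlocQ hrowQ (hsq_torus hM hdiv h2N) h342_1 h342_2 h342_4 hQ hloc hinv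

end Entry4

/-! ## §6  Non-vacuity of the model's side conditions -/

/-- The arithmetic side conditions of the model (`1 ≤ M₀`, `M₀ ∣ N_i`, `2M₀ ≤ N_i`, `NeZero (N i)`) are jointly
satisfiable: d = 1, all periods 2, M₀ = 1. [folklore] -/
example : ∃ (M₀ : ℕ) (N : Fin 1 → ℕ), 1 ≤ M₀ ∧ (∀ i, M₀ ∣ N i) ∧ (∀ i, 2 * M₀ ≤ N i) ∧ ∀ i, NeZero (N i) :=
  ⟨1, fun _ => 2, le_rfl, fun _ => one_dvd _, fun _ => le_rfl, fun _ => ⟨by norm_num⟩⟩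

/-- In dimension d = 1 with period 2 and M₀ = 1 the discharged sizes are the concrete numbers θ = 4|c₀| and
θ₂ = 52c₀² (the bound `hθ₂_torus` instantiated; non-vacuity of §3). [folklore] -/
example (c₀ : ℝ) (z : Ctr (fun _ : Fin 1 => 2) 1) (x : UT (fun _ : Fin 1 => 2)) :
    |slap bsrc btgt (fun _ : UT (fun _ : Fin 1 => 2) × Fin 1 => c₀) (hSU (fun _ : Fin 1 => 2) 1 z) x|
      ≤ c₀ ^ 2 * (52 * (1 : ℕ) / ((1 : ℕ) : ℝ) ^ 2) :=
  hθ₂_torus (N := fun _ : Fin 1 => 2) le_rfl (fun _ => le_rfl) c₀ z x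

end

end Literature.MathematicalPhysics.QuantumFieldTheory.Balaban1983to89.B9Thm37GluePU
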